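import Mathlib
import HarnessLib
import Summits.PneNP.PneNP.Theorems.AeaCutRectanglesDutyRectangles
import Summits.PneNP.PneNP.Theorems.AeaCutRectanglesSwapBookends

/-!
# Pair-compatibility bookends for X1 (`AeaCutRectangles.FoolingMeasure`) — p4 g2, v2 (p4 g4: sorry-free)

Typed companions of `Cruxes/FoolingMeasure/BarrierNotesP4g2.md` §3 (seat pnp-ideate-p4, gen 2, lens «barrier»).
FRONTIER restricted-model rung (AEA cut rectangles vs NON-3-COL); nothing here bears on P vs NP.

v2 (gen 4): both bookends were PROVED and landed by a prover in
`Theorems/AeaCutRectanglesSwapBookends.lean` (p614064, namespace `…Theorems.AeaCutRectanglesSwapBookends`, with the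
definitions copied verbatim).  This workfile now only RE-EXPORTS them under the crux namespace, so the crux folder carries no
`sorry`: the definitions below are `abbrev`s of the landed ones and the three theorems are one-line applications.

Fix a cut `B`.  Two edge sets `S, S'` are JOINTLY CAPTURABLE at `B` when both cross hybrids
`aliceSide B S ∪ bobSide B S'` and `aliceSide B S' ∪ bobSide B S` are non-3-colourable; a family lies in ONE
valid cut rectangle iff it is pairwise jointly capturable (R8).  Two elementary inequalities bracket X1's
rectangle clause at `B` by the DENSITY of joint capturability under `μ ⊗ μ`:

* `rect_sum_sq_le_pSwap` (UPPER bookend, Cauchy–Schwarz / swap test): for every valid rectangle,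
  `(∑_{(α,β) ∈ 𝓐 ×ˢ 𝓑} μ (α ∪ β))² ≤ pSwap μ B := ∑_{S,S'} μ S · μ S' · [S, S' jointly capturable]`;
  hence `pSwap μ B ≤ δ²` at every near-balanced cut is SUFFICIENT for X1's clause (`rect_sum_le_of_pSwap_le_sq`).
* `exists_validRect_ge_caroWei` (LOWER bookend, weighted Caro–Wei): some valid rectangle has mass at least
  `∑_S μ S / (c_B(S) + 1)`, `c_B(S)` = number of support members NOT jointly capturable with `S`.

X1 sits strictly between the two (it is about how joint capturability CLUSTERS, not its density); both are cheap
sampled diagnostics for candidate supports.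
-/

set_option linter.dupNamespace false

namespace Summit.PneNP.PneNP.Cruxes.FoolingMeasure.SwapBookends

open Finset
open Summit.PneNP.PneNP.Theorems.AeaCutRectanglesDutyRectangles (aliceSide bobSide)

variable {V : Type*} [Fintype V] [DecidableEq V]

/-- Non-3-colourability of the graph spanned by a finite edge set (landed definition, re-exported). -/
abbrev NonCol (S : Finset (Sym2 V)) : Prop :=
  Summit.PneNP.PneNP.Theorems.AeaCutRectanglesSwapBookends.NonCol S

/-- Joint capturability at the cut `B` (landed definition, re-exported). -/
abbrev JointlyCapturable (B : Finset V) (S S' : Finset (Sym2 V)) : Prop :=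
  Summit.PneNP.PneNP.Theorems.AeaCutRectanglesSwapBookends.JointlyCapturable B S S'

/-- The three hypotheses of X1's rectangle clause at the cut `B` (landed definition, re-exported). -/
abbrev ValidRect (B : Finset V) (𝓐 𝓑 : Finset (Finset (Sym2 V))) : Prop :=
  Summit.PneNP.PneNP.Theorems.AeaCutRectanglesSwapBookends.ValidRect B 𝓐 𝓑

/-- Swap mass (landed definition, re-exported). -/
noncomputable abbrev pSwap (μ : Finset (Sym2 V) → ℝ) (B : Finset V) : ℝ :=
  Summit.PneNP.PneNP.Theorems.AeaCutRectanglesSwapBookends.pSwap μ B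

/-- Incompatibility count `c_B(S)` (landed definition, re-exported). -/
noncomputable abbrev incompat (μ : Finset (Sym2 V) → ℝ) (B : Finset V) (S : Finset (Sym2 V)) : ℕ :=
  Summit.PneNP.PneNP.Theorems.AeaCutRectanglesSwapBookends.incompat μ B S

/-- **UPPER BOOKEND (Cauchy–Schwarz / swap test)** — landed as
`AeaCutRectanglesSwapBookends.rect_sum_sq_le_pSwap`. -/
theorem rect_sum_sq_le_pSwap (μ : Finset (Sym2 V) → ℝ) (hμ : ∀ S, 0 ≤ μ S) (B : Finset V)
    (𝓐 𝓑 : Finset (Finset (Sym2 V))) (hR : ValidRect B 𝓐 𝓑) :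
    (∑ q ∈ 𝓐 ×ˢ 𝓑, μ (q.1 ∪ q.2)) ^ 2 ≤ pSwap μ B :=
  Summit.PneNP.PneNP.Theorems.AeaCutRectanglesSwapBookends.rect_sum_sq_le_pSwap μ hμ B 𝓐 𝓑 hR

/-- Consequence: `pSwap μ B ≤ δ²` makes X1's rectangle clause hold at `B` with bound `δ` — landed as
`AeaCutRectanglesSwapBookends.rect_sum_le_of_pSwap_le_sq`. -/
theorem rect_sum_le_of_pSwap_le_sq (μ : Finset (Sym2 V) → ℝ) (hμ : ∀ S, 0 ≤ μ S) (B : Finset V) {δ : ℝ}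
    (hδ : 0 ≤ δ) (hswap : pSwap μ B ≤ δ ^ 2)
    (𝓐 𝓑 : Finset (Finset (Sym2 V))) (hR : ValidRect B 𝓐 𝓑) :
    ∑ q ∈ 𝓐 ×ˢ 𝓑, μ (q.1 ∪ q.2) ≤ δ :=
  Summit.PneNP.PneNP.Theorems.AeaCutRectanglesSwapBookends.rect_sum_le_of_pSwap_le_sq μ hμ B hδ hswap 𝓐 𝓑 hR

/-- **LOWER BOOKEND (weighted Caro–Wei)** — landed as `AeaCutRectanglesSwapBookends.exists_validRect_ge_caroWei`. -/
theorem exists_validRect_ge_caroWei (μ : Finset (Sym2 V) → ℝ) (hμ : ∀ S, 0 ≤ μ S)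
    (hsupp : ∀ S, μ S ≠ 0 → (∀ e ∈ S, ¬ e.IsDiag) ∧ NonCol S) (B : Finset V) :
    ∃ 𝓐 𝓑 : Finset (Finset (Sym2 V)), ValidRect B 𝓐 𝓑 ∧
      ∑ S : Finset (Sym2 V), μ S / ((incompat μ B S : ℝ) + 1) ≤ ∑ q ∈ 𝓐 ×ˢ 𝓑, μ (q.1 ∪ q.2) :=
  Summit.PneNP.PneNP.Theorems.AeaCutRectanglesSwapBookends.exists_validRect_ge_caroWei μ hμ hsupp B

end Summit.PneNP.PneNP.Cruxes.FoolingMeasure.SwapBookends
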